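import Summits.BirchSwinnertonDyer.BirchSwinnertonDyer.Theorems.UniversalToricDescentResidualRankLeOneGrowth
import Summits.BirchSwinnertonDyer.BirchSwinnertonDyer.Theorems.UniversalToricDescentResidualGrowthOfRankOne
import Summits.BirchSwinnertonDyer.BirchSwinnertonDyer.Theorems.UniversalToricDescentTwoSidedMuTransferHowardMuSupply
import Summits.BirchSwinnertonDyer.BirchSwinnertonDyer.Theorems.ByReductionTypeAtTwoTowerLayerDuality
import Literature.NumberTheory.EllipticCurves.IwasawaSelmerModuleFiniteProofs
import HarnessLib

/-!
# Route UniversalToricDescent — THE SELMER SIDE OF RESIDUAL GROWTH (brick E8 of the lead's `STUB-BRIEF-K2beta-v7`):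
# `#((X/pX) ⧸ T^{pⁿ}) ≤ p^{pⁿ + C}` ⟹ `#{s ∈ Sel_{p^∞}(E/K_∞) : p·s = 0, conj_{γ^{pⁿ}} s = s} ≤ p^{pⁿ + C}`, and the conclusion of
# the port stub K2∣β `stub_residualCorankLeOneMultOfBeta` (line `beta-road` v7, crux `TwinAlgMuZeroAtThree`, stmt-BirchSwinnertonDyer-24737)
# VERBATIM from the structural currency «rank one ∧ `μ(X_tors) = 0`» (any prime `p` in §1–§2; `p = 3` in §3)

Width prover `bsd-wall-utd-p1-w2` g11 under lead `bsd-wall-utd-p1` g23 (`--supports stmt-BirchSwinnertonDyer-24737`, helper).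
THEOREMS ONLY (no definition, no named fact, no `sorry`); no `Theses` import. BSD is not proved by any of this; 24737 stays OPEN.

The port of K2∣β along the Eisenstein road (E1–E6 of the brief) ends in «`X = X(E′/K_∞)` finitely generated of `Λ`-rank one with
`μ(X_{Λ-tors}) = 0`»; E7 (lead p746766 `…ResidualGrowthOfRankOne.residual_growth_of_rank_one`, and the hull-free companion
`…ResidualRankLeOneGrowth`) turns that into the GROWTH currency `hgrowth : ∃ C, ∀ n, #((X/pX) ⧸ T^{pⁿ}) ≤ p^{pⁿ + C}`. This file is E8
and the final arrow:

* §1 (X side, pure `Λ`-algebra) `exists_natCard_quotient_layerIdeal_le_of_residual_growth`: `hgrowth` ⟹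
  `∃ C, ∀ n, #(X ⧸ (p, ω_n)X) ≤ p^{pⁿ + C}`, `ω_n = (1+T)^{pⁿ} − 1` (`(p, ω_n) = (p, T^{pⁿ})`: tree `KatoHalfPinch.layerIdeal_eq_towerIdeal`,
  `X5.TowerGap.quotientTowerIdealEquiv`); the same from residual relations / from `finrank ≤ 1 ∧ μ(X_tors) = 0`
  (`…_of_residual_relation`, `…_of_finrank_le_one`); and the EQUIVALENCE `muInvariant_torsion_eq_zero_iff_residual_growth` on modules of
  `Λ`-rank one (⟹ `…ResidualRankLeOneGrowth`; ⟸ the lead's p733606 `…ResidualCorankOne.muInvariant_torsion_eq_zero_of_residual_growth`).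
* §2 (Selmer side, any `p`, any number field, any `ℤ_p`-extension `κ`, any `γ`, any Pontryagin-dual datum `D` with `X = D.X` finitely
  generated) `exists_natCard_fixedPTorsion_le_of_residual_growth`: `hgrowth` for `X` ⟹
  **`∃ C, ∀ n, #{s ∈ Sel_{p^∞}(E/K_∞) : p·s = 0, conj_{γ^{pⁿ}} s = s} ≤ p^{pⁿ + C}`** through the tree's EXACT duality count
  `TowerLayer.natCard_quotient_layerIdeal_eq` (`#X/(p, ω_n)X = #{…}`); corollaries from residual relations, from `finrank Λ X ≤ 1 ∧ μ(X_tors) = 0`,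
  and from the lead's currency `Module.rank Λ X = 1 ∧ (X_tors/p·X_tors finite)` (`…_of_rank_eq_one_of_finite`).
* §3 (`p = 3`, `W′.baseChange K`, `[Fact (κ.IsTopGenerator γ)]`, set-builder `Nat.card` — the text of the stub's conclusion)
  `k2ResBound_of_residual_growth` / `k2ResBound_of_finrank_le_one_of_mu_eq_zero` / `k2ResBound_of_rank_eq_one_of_finite`: the conclusion of
  `stub_residualCorankLeOneMultOfBeta` VERBATIM from, respectively, `hgrowth`, «`finrank ≤ 1 ∧ μ(X_tors) = 0`», «`rank = 1 ∧ X_tors/3X_tors`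
  finite», for ANY dual datum of `Sel_{3^∞}(E′_K/K_∞)` (its `X` is finitely generated: `SelmerDualData.module_finite_holds`).

References: [GreenbergLNM1716] §1 p. 60 (`X/𝔪X` dual to `Sel[𝔪]`), p. 62; [Washington1997] §13.2 (`ω_n`); [Howard2004HeegnerKolyvagin]
Thm. B (the currency); the statements are folklore dictionary entries.
-/

set_option linter.dupNamespace false
set_option autoImplicit false

noncomputable section

open scoped Classical

namespace Summit.BirchSwinnertonDyer.BirchSwinnertonDyer.Theorems.UniversalToricDescentResidualGrowthSelmerSide

open Literature.NumberTheory.EllipticCurves Literature.NumberTheory.EllipticCurves.IwasawaAlgebra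
  Summit.BirchSwinnertonDyer.BirchSwinnertonDyer.Theorems.UniversalToricDescentResidualRankLeOneGrowth
  Summit.BirchSwinnertonDyer.BirchSwinnertonDyer.Theorems.UniversalToricDescentResidualCorankOne
  Summit.BirchSwinnertonDyer.Rank1Residual.X5.TowerGap

/-! ## §1 The X side: `#(X ⧸ (p, ω_n)X) ≤ p^{pⁿ + C}` -/

section Lambda

variable {p : ℕ} [Fact p.Prime]
variable {M : Type*} [AddCommGroup M] [Module (IwasawaAlgebra p) M]

/-- **Growth ⟹ layer growth.** `∃ C, ∀ n, #((X/pX) ⧸ T^{pⁿ}) ≤ p^{pⁿ + C}` ⟹ `∃ C, ∀ n, #(X ⧸ (p, ω_n)X) ≤ p^{pⁿ + C}`,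
`ω_n = (1+T)^{pⁿ} − 1`: `(p, ω_n) = (p, T^{pⁿ})` as ideals of `Λ` and `X/(p, T^{pⁿ})X ≅ (X/pX)/T^{pⁿ}` (third isomorphism theorem).
[cite: Washington1997, §13.2] -/
theorem exists_natCard_quotient_layerIdeal_le_of_residual_growth
    (hgrowth : ∃ C : ℕ, ∀ n : ℕ,
      Nat.card ((M ⧸ (augIdealP p • (⊤ : Submodule (IwasawaAlgebra p) M))) ⧸
        (Ideal.span {((PowerSeries.X : IwasawaAlgebra p) ^ (p ^ n))} •
          (⊤ : Submodule (IwasawaAlgebra p) (M ⧸ (augIdealP p • (⊤ : Submodule (IwasawaAlgebra p) M)))))) ≤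
      p ^ (p ^ n + C)) :
    ∃ C : ℕ, ∀ n : ℕ,
      Nat.card (M ⧸ Ideal.span {(PowerSeries.C (p : ℤ_[p]) : IwasawaAlgebra p),
          (1 + (PowerSeries.X : IwasawaAlgebra p)) ^ p ^ n - 1} • (⊤ : Submodule (IwasawaAlgebra p) M)) ≤
        p ^ (p ^ n + C) := by
  obtain ⟨C, hC⟩ := hgrowth
  refine ⟨C, fun n => ?_⟩
  have e := quotientTowerIdealEquiv p (M := M) (p ^ n)
  rw [KatoHalfPinch.layerIdeal_eq_towerIdeal (p := p) n, Nat.card_congr e.toEquiv]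
  have hm := hC n
  rw [← Ideal.span_singleton_pow] at hm
  exact hm

/-- **Residual relations ⟹ layer growth `#(X ⧸ (p, ω_n)X) ≤ p^{pⁿ + C}`** for `X` finitely generated in which any two elements satisfy a
relation with a coefficient outside `pΛ` (`…ResidualRankLeOneGrowth.exists_natCard_residualQuotient_le_of_residual_relation` at `m = pⁿ`).
[cite: Washington1997, §13.2] -/
theorem exists_natCard_quotient_layerIdeal_le_of_residual_relation [Module.Finite (IwasawaAlgebra p) M]
    (hdep : ∀ u v : M, ∃ a b : IwasawaAlgebra p, (a ∉ augIdealP p ∨ b ∉ augIdealP p) ∧ a • u + b • v = 0) :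
    ∃ C : ℕ, ∀ n : ℕ,
      Nat.card (M ⧸ Ideal.span {(PowerSeries.C (p : ℤ_[p]) : IwasawaAlgebra p),
          (1 + (PowerSeries.X : IwasawaAlgebra p)) ^ p ^ n - 1} • (⊤ : Submodule (IwasawaAlgebra p) M)) ≤
        p ^ (p ^ n + C) := by
  obtain ⟨C, hC⟩ := exists_natCard_residualQuotient_le_of_residual_relation hdep
  exact exists_natCard_quotient_layerIdeal_le_of_residual_growth ⟨C, fun n => hC (p ^ n)⟩

/-- **Rank `≤ 1` and `μ(X_tors) = 0` ⟹ layer growth `#(X ⧸ (p, ω_n)X) ≤ p^{pⁿ + C}`** — the X-side form of «`#Sel[p]^{Γ_n} ≤ p^{pⁿ + C}`».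
[cite: Washington1997, §13.2] [cite: GreenbergLNM1716, §1 p. 60] -/
theorem exists_natCard_quotient_layerIdeal_le_of_finrank_le_one [Module.Finite (IwasawaAlgebra p) M]
    (h1 : Module.finrank (IwasawaAlgebra p) M ≤ 1)
    (hμ : muInvariant p (Submodule.torsion (IwasawaAlgebra p) M) = 0) :
    ∃ C : ℕ, ∀ n : ℕ,
      Nat.card (M ⧸ Ideal.span {(PowerSeries.C (p : ℤ_[p]) : IwasawaAlgebra p),
          (1 + (PowerSeries.X : IwasawaAlgebra p)) ^ p ^ n - 1} • (⊤ : Submodule (IwasawaAlgebra p) M)) ≤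
        p ^ (p ^ n + C) :=
  exists_natCard_quotient_layerIdeal_le_of_residual_relation (exists_residual_relation h1 hμ)

/-- **The two currencies agree on modules of `Λ`-rank one.** For `X` finitely generated with `Module.finrank Λ X = 1`:
`μ(X_{Λ-tors}) = 0` **iff** `∃ C, ∀ n, #((X/pX) ⧸ T^{pⁿ}) ≤ p^{pⁿ + C}` (⟹ `…ResidualRankLeOneGrowth`; ⟸ the lead's
`…ResidualCorankOne.muInvariant_torsion_eq_zero_of_residual_growth`, p733606). [cite: Washington1997, §13.2]
[cite: GreenbergVatsal2000, §2 Prop. (2.8)] -/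
theorem muInvariant_torsion_eq_zero_iff_residual_growth [Module.Finite (IwasawaAlgebra p) M]
    (h1 : Module.finrank (IwasawaAlgebra p) M = 1) :
    muInvariant p (Submodule.torsion (IwasawaAlgebra p) M) = 0 ↔
      ∃ C : ℕ, ∀ n : ℕ,
        Nat.card ((M ⧸ (augIdealP p • (⊤ : Submodule (IwasawaAlgebra p) M))) ⧸
          (Ideal.span {((PowerSeries.X : IwasawaAlgebra p) ^ (p ^ n))} •
            (⊤ : Submodule (IwasawaAlgebra p) (M ⧸ (augIdealP p • (⊤ : Submodule (IwasawaAlgebra p) M)))))) ≤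
        p ^ (p ^ n + C) := by
  constructor
  · intro hμ
    obtain ⟨C, hC⟩ := exists_natCard_residualQuotient_le_of_finrank_le_one h1.le hμ
    exact ⟨C, fun n => hC (p ^ n)⟩
  · rintro ⟨C, hC⟩
    exact muInvariant_torsion_eq_zero_of_residual_growth
      (UniversalToricDescentTwoSidedMuTransfer.not_isTorsion_of_finrank_eq_one h1) C hC

end Lambda

/-! ## §2 The Selmer side: `#{s ∈ Sel_{p^∞}(E/K_∞) : p·s = 0, conj_{γ^{pⁿ}} s = s} ≤ p^{pⁿ + C}` -/

section Selmer

open WeierstrassCurve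

universe u

variable {K : Type u} [Field K] [NumberField K] {W : WeierstrassCurve K} {p : ℕ} [Fact p.Prime]
  {κ : ZpExtension K p} {γ : Field.absoluteGaloisGroup K}

/-- **E8: growth of `X` ⟹ `#Sel_∞[p]^{γ^{pⁿ}} ≤ p^{pⁿ + C}`.** For any Pontryagin-dual datum `D` of `Sel_∞ = Sel_{p^∞}(E/K_∞)` over `(κ, γ)`
with `X = D.X` finitely generated and `∃ C, ∀ n, #((X/pX) ⧸ T^{pⁿ}) ≤ p^{pⁿ + C}`:
`∃ C, ∀ n, #{s ∈ Sel_∞ : p·s = 0, conj_{γ^{pⁿ}} s = s} ≤ p^{pⁿ + C}` — §1 and the EXACT duality count `#X/(p, ω_n)X = #{…}`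
(`TowerLayer.natCard_quotient_layerIdeal_eq`). [cite: GreenbergLNM1716, §1 p. 60] [cite: Washington1997, §13.2] -/
theorem exists_natCard_fixedPTorsion_le_of_residual_growth (D : W.SelmerDualData κ γ)
    [Module.Finite (IwasawaAlgebra p) D.X]
    (hgrowth : ∃ C : ℕ, ∀ n : ℕ,
      Nat.card ((D.X ⧸ (augIdealP p • (⊤ : Submodule (IwasawaAlgebra p) D.X))) ⧸
        (Ideal.span {((PowerSeries.X : IwasawaAlgebra p) ^ (p ^ n))} •
          (⊤ : Submodule (IwasawaAlgebra p) (D.X ⧸ (augIdealP p • (⊤ : Submodule (IwasawaAlgebra p) D.X)))))) ≤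
      p ^ (p ^ n + C)) :
    ∃ C : ℕ, ∀ n : ℕ,
      Nat.card {s : W.selmerInfty κ // p • s = 0 ∧
        W.conjH1 p κ.kerSubgroup (γ ^ p ^ n) (s : W.subgroupH1 p κ.kerSubgroup) = s} ≤ p ^ (p ^ n + C) := by
  obtain ⟨C, hC⟩ := exists_natCard_quotient_layerIdeal_le_of_residual_growth hgrowth
  refine ⟨C, fun n => ?_⟩
  rw [← TowerLayer.natCard_quotient_layerIdeal_eq D n]
  exact hC n

/-- **Residual relations on `X` ⟹ `#Sel_∞[p]^{γ^{pⁿ}} ≤ p^{pⁿ + C}`** (any dual datum `D`, `X = D.X` finitely generated in which any two elements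
satisfy a relation with a coefficient outside `pΛ`). [cite: GreenbergLNM1716, §1 p. 60] -/
theorem exists_natCard_fixedPTorsion_le_of_residual_relation (D : W.SelmerDualData κ γ)
    [Module.Finite (IwasawaAlgebra p) D.X]
    (hdep : ∀ u v : D.X, ∃ a b : IwasawaAlgebra p, (a ∉ augIdealP p ∨ b ∉ augIdealP p) ∧ a • u + b • v = 0) :
    ∃ C : ℕ, ∀ n : ℕ,
      Nat.card {s : W.selmerInfty κ // p • s = 0 ∧
        W.conjH1 p κ.kerSubgroup (γ ^ p ^ n) (s : W.subgroupH1 p κ.kerSubgroup) = s} ≤ p ^ (p ^ n + C) := by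
  obtain ⟨C, hC⟩ := exists_natCard_quotient_layerIdeal_le_of_residual_relation hdep
  refine ⟨C, fun n => ?_⟩
  rw [← TowerLayer.natCard_quotient_layerIdeal_eq D n]
  exact hC n

/-- **Rank `≤ 1` and `μ(X_tors) = 0` ⟹ `#Sel_∞[p]^{γ^{pⁿ}} ≤ p^{pⁿ + C}`.** For an elliptic curve `E = W` over a number field `K`, a prime `p`, a
`ℤ_p`-extension `κ`, any `γ`, and any Pontryagin-dual datum `D` of `Sel_{p^∞}(E/K_∞)` over `(κ, γ)` with `X = D.X` finitely generated of
`Λ`-rank `≤ 1` and `μ(X_{Λ-tors}) = 0`: `∃ C, ∀ n, #{s ∈ Sel_∞ : p·s = 0, conj_{γ^{pⁿ}} s = s} ≤ p^{pⁿ + C}`.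
[cite: GreenbergLNM1716, §1 p. 60, p. 62] [cite: Washington1997, §13.2] -/
theorem exists_natCard_fixedPTorsion_le_of_finrank_le_one (D : W.SelmerDualData κ γ)
    [Module.Finite (IwasawaAlgebra p) D.X]
    (h1 : Module.finrank (IwasawaAlgebra p) D.X ≤ 1)
    (hμ : muInvariant p (Submodule.torsion (IwasawaAlgebra p) D.X) = 0) :
    ∃ C : ℕ, ∀ n : ℕ,
      Nat.card {s : W.selmerInfty κ // p • s = 0 ∧
        W.conjH1 p κ.kerSubgroup (γ ^ p ^ n) (s : W.subgroupH1 p κ.kerSubgroup) = s} ≤ p ^ (p ^ n + C) :=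
  exists_natCard_fixedPTorsion_le_of_residual_relation D (exists_residual_relation h1 hμ)

/-- **The lead's currency: rank one and `X_tors/p·X_tors` finite ⟹ `#Sel_∞[p]^{γ^{pⁿ}} ≤ p^{pⁿ + C}`** (any dual datum `D`, `X = D.X` finitely
generated with `Module.rank Λ X = 1` and finite residual torsion quotient), through the lead's p746766
`…ResidualGrowthOfRankOne.residual_growth_of_rank_one` and E8. [cite: GreenbergLNM1716, §1 p. 60] [cite: Washington1997, §13.2] -/
theorem exists_natCard_fixedPTorsion_le_of_rank_eq_one_of_finite (D : W.SelmerDualData κ γ)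
    [Module.Finite (IwasawaAlgebra p) D.X]
    (hrank : Module.rank (IwasawaAlgebra p) D.X = 1)
    (hfin : Finite (↥(Submodule.torsion (IwasawaAlgebra p) D.X) ⧸
      (augIdealP p • (⊤ : Submodule (IwasawaAlgebra p) ↥(Submodule.torsion (IwasawaAlgebra p) D.X))))) :
    ∃ C : ℕ, ∀ n : ℕ,
      Nat.card {s : W.selmerInfty κ // p • s = 0 ∧
        W.conjH1 p κ.kerSubgroup (γ ^ p ^ n) (s : W.subgroupH1 p κ.kerSubgroup) = s} ≤ p ^ (p ^ n + C) :=
  exists_natCard_fixedPTorsion_le_of_residual_growth D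
    (UniversalToricDescentResidualGrowthOfRankOne.residual_growth_of_rank_one hrank hfin)

end Selmer

/-! ## §3 The conclusion of K2∣β (`stub_residualCorankLeOneMultOfBeta`) VERBATIM -/

section K2

open WeierstrassCurve

/-- **K2∣β's conclusion from the growth of `X`.** For `E′ = W′/ℚ` elliptic, a number field `K`, a `ℤ₃`-extension `κ` of `K` with topological
generator `γ`, and ANY Pontryagin-dual datum `D` of `Sel_{3^∞}(E′_K/K_∞)` over `(κ, γ)` (its `X` is finitely generated:
`SelmerDualData.module_finite_holds`) whose residual layers grow like one copy of `𝔽₃⟦T⟧` (`∃ C, ∀ n, #((X/3X) ⧸ T^{3ⁿ}) ≤ 3^{3ⁿ + C}`), the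
conclusion of the registered stub `stub_residualCorankLeOneMultOfBeta` (line `beta-road` v7, crux `TwinAlgMuZeroAtThree`) holds VERBATIM.
[cite: GreenbergLNM1716, §1 p. 60, p. 62] -/
theorem k2ResBound_of_residual_growth
    (W' : WeierstrassCurve ℚ) [W'.IsElliptic] (K : Type) [Field K] [NumberField K]
    (κ : ZpExtension K 3) (γ : Field.absoluteGaloisGroup K) [hγ : Fact (κ.IsTopGenerator γ)]
    (D : (W'.baseChange K).SelmerDualData κ γ)
    (hgrowth : ∃ C : ℕ, ∀ n : ℕ,
      Nat.card ((D.X ⧸ (augIdealP 3 • (⊤ : Submodule (IwasawaAlgebra 3) D.X))) ⧸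
        (Ideal.span {((PowerSeries.X : IwasawaAlgebra 3) ^ (3 ^ n))} •
          (⊤ : Submodule (IwasawaAlgebra 3) (D.X ⧸ (augIdealP 3 • (⊤ : Submodule (IwasawaAlgebra 3) D.X)))))) ≤
      3 ^ (3 ^ n + C)) :
    ∃ C : ℕ, ∀ n : ℕ,
      Nat.card {s : (W'.baseChange K).selmerInfty κ |
        3 • s = 0 ∧ (W'.baseChange K).conjH1 3 κ.kerSubgroup (γ ^ 3 ^ n)
          (s : (W'.baseChange K).subgroupH1 3 κ.kerSubgroup) = s} ≤ 3 ^ (3 ^ n + C) := by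
  haveI : (W'.baseChange K).IsElliptic := by rw [WeierstrassCurve.baseChange]; infer_instance
  haveI : Module.Finite (IwasawaAlgebra 3) D.X := D.module_finite_holds hγ.out
  obtain ⟨C, hC⟩ := exists_natCard_fixedPTorsion_le_of_residual_growth D hgrowth
  exact ⟨C, fun n => hC n⟩

/-- **K2∣β's conclusion from «rank `≤ 1` and `μ(X_tors) = 0`».** Same setting; hypothesis: `Module.finrank Λ X ≤ 1` and
`μ(X_{Λ-tors}) = 0` for some (any) dual datum `D` of `Sel_{3^∞}(E′_K/K_∞)` — the structural currency in which a Howard-type port of K2∣β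
ends (the tree's `howardMu_*` currency). [cite: GreenbergLNM1716, §1 p. 60, p. 62] [cite: Howard2004HeegnerKolyvagin, Thm. B] -/
theorem k2ResBound_of_finrank_le_one_of_mu_eq_zero
    (W' : WeierstrassCurve ℚ) [W'.IsElliptic] (K : Type) [Field K] [NumberField K]
    (κ : ZpExtension K 3) (γ : Field.absoluteGaloisGroup K) [hγ : Fact (κ.IsTopGenerator γ)]
    (D : (W'.baseChange K).SelmerDualData κ γ)
    (h1 : Module.finrank (IwasawaAlgebra 3) D.X ≤ 1)
    (hμ : muInvariant 3 (Submodule.torsion (IwasawaAlgebra 3) D.X) = 0) :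
    ∃ C : ℕ, ∀ n : ℕ,
      Nat.card {s : (W'.baseChange K).selmerInfty κ |
        3 • s = 0 ∧ (W'.baseChange K).conjH1 3 κ.kerSubgroup (γ ^ 3 ^ n)
          (s : (W'.baseChange K).subgroupH1 3 κ.kerSubgroup) = s} ≤ 3 ^ (3 ^ n + C) := by
  haveI : (W'.baseChange K).IsElliptic := by rw [WeierstrassCurve.baseChange]; infer_instance
  haveI : Module.Finite (IwasawaAlgebra 3) D.X := D.module_finite_holds hγ.out
  obtain ⟨C, hC⟩ := exists_natCard_fixedPTorsion_le_of_finrank_le_one D h1 hμ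
  exact ⟨C, fun n => hC n⟩

/-- **K2∣β's conclusion from the lead's currency «rank one and `X_tors/3·X_tors` finite».** Same setting; hypothesis:
`Module.rank Λ X = 1` and `X_tors ⧸ 3·X_tors` finite for some (any) dual datum `D` of `Sel_{3^∞}(E′_K/K_∞)` (the hypotheses of the lead's
p746766 `…ResidualGrowthOfRankOne.residual_growth_of_rank_one`, verbatim). [cite: GreenbergLNM1716, §1 p. 60, p. 62] -/
theorem k2ResBound_of_rank_eq_one_of_finite
    (W' : WeierstrassCurve ℚ) [W'.IsElliptic] (K : Type) [Field K] [NumberField K]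
    (κ : ZpExtension K 3) (γ : Field.absoluteGaloisGroup K) [hγ : Fact (κ.IsTopGenerator γ)]
    (D : (W'.baseChange K).SelmerDualData κ γ)
    (hrank : Module.rank (IwasawaAlgebra 3) D.X = 1)
    (hfin : Finite (↥(Submodule.torsion (IwasawaAlgebra 3) D.X) ⧸
      (augIdealP 3 • (⊤ : Submodule (IwasawaAlgebra 3) ↥(Submodule.torsion (IwasawaAlgebra 3) D.X))))) :
    ∃ C : ℕ, ∀ n : ℕ,
      Nat.card {s : (W'.baseChange K).selmerInfty κ |
        3 • s = 0 ∧ (W'.baseChange K).conjH1 3 κ.kerSubgroup (γ ^ 3 ^ n)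
          (s : (W'.baseChange K).subgroupH1 3 κ.kerSubgroup) = s} ≤ 3 ^ (3 ^ n + C) := by
  haveI : (W'.baseChange K).IsElliptic := by rw [WeierstrassCurve.baseChange]; infer_instance
  haveI : Module.Finite (IwasawaAlgebra 3) D.X := D.module_finite_holds hγ.out
  obtain ⟨C, hC⟩ := exists_natCard_fixedPTorsion_le_of_rank_eq_one_of_finite D hrank hfin
  exact ⟨C, fun n => hC n⟩

end K2

end Summit.BirchSwinnertonDyer.BirchSwinnertonDyer.Theorems.UniversalToricDescentResidualGrowthSelmerSide

end
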